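import Summits.Schanuel.Schanuel.Theorems.ZilberEacDegenerateDirectionGuard
import Summits.Schanuel.Schanuel.Theorems.ZilberEacYOneAdicReduction
import Summits.Schanuel.Schanuel.Theorems.ZilberEacRelationAllSurfaces
import Summits.Schanuel.Schanuel.Theorems.ZilberEacCylinderCriterion
import Summits.Schanuel.Schanuel.Theorems.ZilberEacTransposeRows
import HarnessLib

/-!
# The exponential-polynomial regime, CXX: THE `∀ W` THEOREM — EVERY SURFACE OF MANTOVA–MASSER'S
# CASE WITH A BOTTOM EDGE, OVER A CURVE WITH A DEGENERATE DIRECTION, IS DENSE (O92 (a))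

HONEST FRAMING.  Cell `pub-schanuel` (Zilber's Exponential-Algebraic Closedness, case ladder;
host summit Schanuel), seat 2, gen 35.  Files CVIII–CXVII (gen 34) built the degenerate-direction
engine in S-form and decided Mantova–Masser's own example (fermat).  Here the intrinsic `∀ W`
form.  Let `F ∈ ℂ[x₀][x₁]` be irreducible of positive `x₁`-degree with an unbounded place
`x₀ = s^{-k}`, `x₁ = Φ(s)s^{-M}` (`k, M ≥ 1`) and a DEGENERATE DIRECTION: `z^k = 2πi` with
`Re(Φ(0)z^M) < 0` (so `e^{x₁} → 0` super-exponentially where `e^{x₀}` stays on a circle).  Let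
`W` be a surface of Mantova–Masser's case (dim-π-S-1-free) with base curve `{F = 0}` whose
BOTTOM EDGE is visible: the part of `W ∩ {y₁ = 0}` with `y₀ ≠ 0` projects Zariski-densely to the
curve (`hbottom`; equivalently the fibre relation of `W` restricted to `y₁ = 0` has a nonzero
root over the generic point of the curve).  Then:
* **`unprojectedDense_of_mmCase_bottomEdge`**: if moreover `x₀, x₁, y₁` satisfy no relation on
  `W` beyond `F` (`hfree`; ANY coefficients), the unprojected exponential points are Zariski dense
  in `W`;
* **`unprojectedDense_of_mmCase_bottomEdge_algebraic`**: for `F ∈ ℚ̄[x₀][x₁]` the hypothesis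
  `hfree` is removed (its failure makes `W` a `y₀`-cylinder, dense by file XCVIII).
Proof: `ℂ[x₀,x₁,y₀,y₁] = B[y₀]`, `B = ℂ[x₀,x₁,y₁]`; the minimal polynomial `P ∈ B[y₀]` of `I(W)`
over the prime `F` (file CII) is written `y₁`-adically modulo `F` as `y₁^r P'` (file CXIX);
`P'` vanishes on `W` (primality, `y₁ ∉ I(W)`), its degenerate part `G₀ = P'(x, 0; y₀)` has a
coefficient `∉ (F)` by construction and a second one by `hbottom`; the guarded engine of file
CXVIII (guard `lc(P)`) and the division property `lc(P)^k G = QP + FH` give the density with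
`S = W`.  Decided sub-class of an OPEN question (Mantova–Masser PLMS 2024 §1 p. 5); curves all
of whose places have real slopes with `k = M`, transcendental coefficients, Fib(3,2), EC(3,2):
OPEN; NOT Schanuel's conjecture (neither used nor implied); EAC ⇏ SC.
-/

noncomputable section

open Filter Topology Set Complex Polynomial
open Literature.NumberTheory.Transcendental Literature.ModelTheory.Zilber
open Literature.ModelTheory.ExponentialFields

set_option linter.dupNamespace false

namespace Summit.Schanuel.Schanuel.Theorems

section DegenerateAllSurfaces

variable (F : ℂ[X][X])

/-- **THE `∀ W` THEOREM OF THE EXPONENTIAL-POLYNOMIAL REGIME (free form).**  `F` irreducible of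
positive `x₁`-degree; a place `x₀ = s^{-k}`, `x₁ = Φ(s)s^{-M}` (`k, M ≥ 1`) with a degenerate
direction `z^k = 2πi`, `Re(Φ(0)z^M) < 0`; `F₃` = `F` inside `ℂ[x₀, x₁, y₁]`; `W` in
Mantova–Masser's case with base curve `{F = 0}` such that (`hfree`) every `H ∈ ℂ[x₀, x₁, y₁]`
vanishing on `W` is divisible by `F₃` and (`hbottom`) every `H ∈ ℂ[x₀][x₁]` vanishing at the
points of `W` with `y₁ = 0 ≠ y₀` is divisible by `F`.  Then the unprojected exponential points
are Zariski dense in `W`. [cite: MantovaMasser2023, §1 Further remarks, p. 5 (the question, open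
in general)] (new) -/
theorem unprojectedDense_of_mmCase_bottomEdge (hFirr : Irreducible F) (hn : 1 ≤ F.natDegree)
    {k : ℕ} (hk : 1 ≤ k) {M : ℕ} (hM : 1 ≤ M) {Φ : ℂ → ℂ} (hΦan : AnalyticAt ℂ Φ 0)
    (hplace : ∀ᶠ s in 𝓝[≠] (0 : ℂ),
      (F.map (Polynomial.evalRingHom (s ^ k)⁻¹)).eval (Φ s * (s ^ M)⁻¹) = 0)
    {z : ℂ} (hz : z ^ k = 2 * Real.pi * I) (hdir : (Φ 0 * z ^ M).re < 0)
    (F₃ : MvPolynomial (Fin 3) ℂ)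
    (hF₃ : ∀ v : Fin 3 → ℂ, MvPolynomial.eval v F₃ = (F.map (Polynomial.evalRingHom (v 0))).eval (v 1))
    {W : Set (Fin 2 ⊕ Fin 2 → ℂ)} (hmm : MMCaseDimPiOneFree W)
    (hbase : MvPolynomial.zeroLocus ℂ (MvPolynomial.vanishingIdeal ℂ (projAdd '' (W ∩ torusLocus ℂ 2))) =
      {x : Fin 2 → ℂ | (F.map (Polynomial.evalRingHom (x 0))).eval (x 1) = 0})
    (hfree : ∀ H : MvPolynomial (Fin 3) ℂ,
      (∀ w ∈ W, MvPolynomial.eval ![w (Sum.inl 0), w (Sum.inl 1), w (Sum.inr 1)] H = 0) → F₃ ∣ H)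
    (hbottom : ∀ H : ℂ[X][X], (∀ w ∈ W, w (Sum.inr 1) = 0 → w (Sum.inr 0) ≠ 0 →
      (H.map (Polynomial.evalRingHom (w (Sum.inl 0)))).eval (w (Sum.inl 1)) = 0) → F ∣ H) :
    UnprojectedDense W := by
  classical
  -- the embedding `ι : B[y₀] → ℂ[x₀, x₁, y₀, y₁]`, `B = ℂ[x₀, x₁, y₁]` (as in file CIII)
  set ι : Polynomial (MvPolynomial (Fin 3) ℂ) →+* MvPolynomial (Fin 2 ⊕ Fin 2) ℂ :=
    Polynomial.eval₂RingHom (MvPolynomial.eval₂Hom (S₁ := MvPolynomial (Fin 2 ⊕ Fin 2) ℂ)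
      MvPolynomial.C (![MvPolynomial.X (Sum.inl 0), MvPolynomial.X (Sum.inl 1),
        MvPolynomial.X (Sum.inr 1)] : Fin 3 → MvPolynomial (Fin 2 ⊕ Fin 2) ℂ))
      (MvPolynomial.X (Sum.inr 0)) with hι
  have hC : ∀ a : ℂ, ι (Polynomial.C (MvPolynomial.C a)) = MvPolynomial.C a := by
    intro a
    simp only [hι, Polynomial.coe_eval₂RingHom, Polynomial.eval₂_C, MvPolynomial.coe_eval₂Hom,
      MvPolynomial.eval₂_C]
  have h0 : ι (Polynomial.C (MvPolynomial.X 0)) = MvPolynomial.X (Sum.inl 0) := by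
    simp only [hι, Polynomial.coe_eval₂RingHom, Polynomial.eval₂_C, MvPolynomial.coe_eval₂Hom,
      MvPolynomial.eval₂_X, Matrix.cons_val_zero]
  have h1 : ι (Polynomial.C (MvPolynomial.X 1)) = MvPolynomial.X (Sum.inl 1) := by
    simp only [hι, Polynomial.coe_eval₂RingHom, Polynomial.eval₂_C, MvPolynomial.coe_eval₂Hom,
      MvPolynomial.eval₂_X, Matrix.cons_val_one, Matrix.cons_val_zero]
  have h2 : ι (Polynomial.C (MvPolynomial.X 2)) = MvPolynomial.X (Sum.inr 1) := by
    simp only [hι, Polynomial.coe_eval₂RingHom, Polynomial.eval₂_C, MvPolynomial.coe_eval₂Hom,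
      MvPolynomial.eval₂_X]; rfl
  have hX : ι Polynomial.X = MvPolynomial.X (Sum.inr 0) := by
    simp only [hι, Polynomial.coe_eval₂RingHom, Polynomial.eval₂_X]
  have hev := eval_embed₄ ι hC h0 h1 h2 hX
  -- the prime `𝔭 = I(W)`
  set 𝔭 : Ideal (MvPolynomial (Fin 2 ⊕ Fin 2) ℂ) := MvPolynomial.vanishingIdeal ℂ W with h𝔭
  haveI h𝔭p : 𝔭.IsPrime := hmm.1.2
  have hmem : ∀ G : Polynomial (MvPolynomial (Fin 3) ℂ), ι G ∈ 𝔭 ↔ ∀ w ∈ W,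
      (G.map (MvPolynomial.eval ![w (Sum.inl 0), w (Sum.inl 1), w (Sum.inr 1)])).eval
        (w (Sum.inr 0)) = 0 := by
    intro G
    rw [h𝔭, MvPolynomial.mem_vanishingIdeal_iff]
    refine forall₂_congr fun w _ => ?_
    rw [MvPolynomial.aeval_eq_eval, hev]
  obtain ⟨w₀, hw₀W, hw₀T⟩ := hmm.2.1
  have hy : ∀ i : Fin 2, (MvPolynomial.X (Sum.inr i) : MvPolynomial (Fin 2 ⊕ Fin 2) ℂ) ∉ 𝔭 := by
    intro i hi
    rw [h𝔭, MvPolynomial.mem_vanishingIdeal_iff] at hi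
    have h := hi w₀ hw₀W
    rw [MvPolynomial.aeval_eq_eval, MvPolynomial.eval_X] at h
    exact (mem_torusLocus_iff.1 hw₀T) i h
  have hXmem : ι Polynomial.X ∉ 𝔭 := by rw [hX]; exact hy 0
  -- `F ∈ 𝔭`
  have hFW : ∀ w ∈ W, w ∈ torusLocus ℂ 2 →
      (F.map (Polynomial.evalRingHom (w (Sum.inl 0)))).eval (w (Sum.inl 1)) = 0 := by
    intro w hwW hwT
    have hcl : projAdd w ∈ MvPolynomial.zeroLocus ℂ
        (MvPolynomial.vanishingIdeal ℂ (projAdd '' (W ∩ torusLocus ℂ 2))) :=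
      MvPolynomial.zeroLocus_vanishingIdeal_le _ ⟨w, ⟨hwW, hwT⟩, rfl⟩
    rw [hbase] at hcl
    exact hcl
  have hFmem : ι (Polynomial.C F₃) ∈ 𝔭 := by
    have hprod : ι (Polynomial.C F₃) * MvPolynomial.X (Sum.inr 0) * MvPolynomial.X (Sum.inr 1) ∈ 𝔭 := by
      rw [h𝔭, MvPolynomial.mem_vanishingIdeal_iff]
      intro w hwW
      rw [MvPolynomial.aeval_eq_eval, map_mul, map_mul, hev, MvPolynomial.eval_X, MvPolynomial.eval_X,
        Polynomial.map_C, Polynomial.eval_C, hF₃]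
      simp only [Matrix.cons_val_zero, Matrix.cons_val_one]
      by_cases hwT : w ∈ torusLocus ℂ 2
      · rw [hFW w hwW hwT, zero_mul, zero_mul]
      · rw [mem_torusLocus_iff] at hwT
        push Not at hwT
        obtain ⟨i, hi⟩ := hwT
        fin_cases i
        · simp only [Fin.zero_eta] at hi; rw [hi, mul_zero, zero_mul]
        · simp only [Fin.mk_one] at hi; rw [hi, mul_zero]
    rcases h𝔭p.mem_or_mem hprod with h | h
    · exact (h𝔭p.mem_or_mem h).elim id fun h' => (hy 0 h').elim
    · exact (hy 1 h).elim
  -- hence `F` vanishes on ALL of `W`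
  have hFall : ∀ w ∈ W, (F.map (Polynomial.evalRingHom (w (Sum.inl 0)))).eval (w (Sum.inl 1)) = 0 := by
    intro w hw
    have h := (hmem _).1 hFmem w hw
    rw [Polynomial.map_C, Polynomial.eval_C, hF₃] at h
    simpa only [Matrix.cons_val_zero, Matrix.cons_val_one] using h
  have hconst : ∀ H : MvPolynomial (Fin 3) ℂ, ι (Polynomial.C H) ∈ 𝔭 → F₃ ∣ H := by
    intro H hH
    refine hfree H fun w hw => ?_
    have h := (hmem _).1 hH w hw
    rwa [Polynomial.map_C, Polynomial.eval_C] at h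
  -- `F₃` is prime
  obtain ⟨Φr, hΦr⟩ := exists_rowsEquiv
  have hF₃eq : F₃ = MvPolynomial.rename (Fin.castSucc : Fin 2 → Fin 3) (Φr.symm F) := by
    refine MvPolynomial.funext fun v => ?_
    rw [hF₃, MvPolynomial.eval_rename]
    have e : (v ∘ (Fin.castSucc : Fin 2 → Fin 3)) = ![v 0, v 1] := by
      funext i; fin_cases i <;> rfl
    rw [e, hΦr, RingEquiv.apply_symm_apply]
  have hirrA : Irreducible (Φr.symm F) := by
    refine (irreducible_rows_iff (Q := F) fun x y => ?_).2 hFirr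
    rw [hΦr, RingEquiv.apply_symm_apply]
  have hprimeF₃ : Prime F₃ := by
    rw [hF₃eq]
    exact UniqueFactorizationMonoid.irreducible_iff_prime.1 (irreducible_rename_castSucc₂ hirrA)
  -- a relation with a coefficient `∉ (F₃)` exists: otherwise `𝔭 = (F̃)` and `dim W = 3`
  have hP₀ : ∃ P₀ : Polynomial (MvPolynomial (Fin 3) ℂ), ι P₀ ∈ 𝔭 ∧ ∃ j, ¬ F₃ ∣ P₀.coeff j := by
    by_contra hnone
    push Not at hnone
    have h𝔭eq : 𝔭 = Ideal.span {ι (Polynomial.C F₃)} := by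
      refine le_antisymm ?_ ((Ideal.span_singleton_le_iff_mem _).2 hFmem)
      intro G hG
      obtain ⟨Gy, hGy⟩ := exists_embed₄_poly ι hC h0 h1 h2 hX G
      have hall : ∀ j, F₃ ∣ Gy.coeff j := hnone Gy (by rw [hGy]; exact hG)
      obtain ⟨H, hH⟩ := (Polynomial.C_dvd_iff_dvd_coeff F₃ Gy).2 hall
      rw [Ideal.mem_span_singleton, ← hGy, hH, map_mul]
      exact Dvd.intro _ rfl
    have hFt0 : ι (Polynomial.C F₃) ≠ 0 := by
      intro h0
      apply hFirr.ne_zero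
      have hzero : ∀ x₀ x₁ : ℂ, (F.map (Polynomial.evalRingHom x₀)).eval x₁ = 0 := by
        intro x₀ x₁
        have h := hev (Sum.elim ![x₀, x₁] ![0, 0]) (Polynomial.C F₃)
        rw [h0, map_zero, Polynomial.map_C, Polynomial.eval_C, hF₃] at h
        simpa using h.symm
      refine Polynomial.ext fun j => Polynomial.funext fun x₀ => ?_
      have hG : F.map (Polynomial.evalRingHom x₀) = 0 :=
        Polynomial.funext fun x₁ => by rw [hzero, Polynomial.eval_zero]
      have hj := congrArg (fun G : ℂ[X] => G.coeff j) hG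
      simp only [Polynomial.coeff_map, Polynomial.coe_evalRingHom, Polynomial.coeff_zero] at hj
      rw [Polynomial.coeff_zero, Polynomial.eval_zero]
      exact hj
    have hprime : Prime (ι (Polynomial.C F₃)) := (Ideal.span_singleton_prime hFt0).1 (h𝔭eq ▸ h𝔭p)
    have h𝔭eq' : MvPolynomial.vanishingIdeal ℂ W = Ideal.span {ι (Polynomial.C F₃)} := by
      rw [← h𝔭]; exact h𝔭eq
    set f : MvPolynomial (Fin 2 ⊕ Fin 2) ℂ ≃+* MvPolynomial (Fin 4) ℂ :=
      (MvPolynomial.renameEquiv ℂ finSumFinEquiv).toRingEquiv with hf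
    have hprime' : Prime (f (ι (Polynomial.C F₃))) := (MulEquiv.prime_iff f).2 hprime
    have hmap : Ideal.span {f (ι (Polynomial.C F₃))} =
        (Ideal.span {ι (Polynomial.C F₃)}).map
          (f : MvPolynomial (Fin 2 ⊕ Fin 2) ℂ →+* MvPolynomial (Fin 4) ℂ) := by
      rw [Ideal.map_span, Set.image_singleton]; rfl
    have hdim3 : zariskiDim ℂ W = ((4 - 1 : ℕ) : WithBot ℕ∞) := by
      rw [← Literature.RingTheory.KrullDimension.ringKrullDim_quotient_span_of_prime_mvPolynomial hprime']
      show ringKrullDim (MvPolynomial (Fin 2 ⊕ Fin 2) ℂ ⧸ MvPolynomial.vanishingIdeal ℂ W) = _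
      exact (ringKrullDim_eq_of_ringEquiv (Ideal.quotEquivOfEq h𝔭eq')).trans
        (ringKrullDim_eq_of_ringEquiv (Ideal.quotientEquiv _ _ f hmap))
    have h23 : ((2 : ℕ) : WithBot ℕ∞) = ((4 - 1 : ℕ) : WithBot ℕ∞) := by rw [← hdim3]; exact hmm.2.2.1.symm
    have := Nat.cast_injective (R := WithBot ℕ∞) h23
    omega
  obtain ⟨P₀, hP₀mem, hP₀nd⟩ := hP₀
  -- the minimal polynomial over `B = ℂ[x₀, x₁, y₁]`
  obtain ⟨P, hP, -, htop, -, -, hdiv⟩ :=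
    exists_minimalPolynomial_domain (ι := ι) (𝔭 := 𝔭) hprimeF₃ hFmem hconst hXmem hP₀mem hP₀nd
  -- its `y₁`-adic reduction modulo `F` (file CXIX)
  obtain ⟨r, P', G₀, hPP', hG₀, i₁, hi₁⟩ :=
    exists_yOneAdicReduction F F₃ hF₃ P ⟨P.natDegree, htop⟩
  -- `P'` vanishes on `W`: `y₁^r P' ≡ P (mod F)` on `W`, `𝔭` prime, `y₁ ∉ 𝔭`
  have hP'mem : ι P' ∈ 𝔭 := by
    have hprod : ι (Polynomial.C (MvPolynomial.X 2) ^ r * P') ∈ 𝔭 := by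
      rw [hmem]
      intro w hw
      have hPw := (hmem P).1 hP w hw
      rw [hPP' _ _ _ _ (hFall w hw)] at hPw
      rw [Polynomial.map_mul, Polynomial.map_pow, Polynomial.map_C, Polynomial.eval_mul,
        Polynomial.eval_pow, Polynomial.eval_C, MvPolynomial.eval_X]
      simpa only [Matrix.cons_val_two, Matrix.tail_cons, Matrix.head_cons] using hPw
    rw [map_mul, map_pow, h2] at hprod
    rcases h𝔭p.mem_or_mem hprod with h | h
    · exact ((hy 1) (h𝔭p.mem_of_pow_mem _ h)).elim
    · exact h
  -- two coefficients of `G₀` are not divisible by `F` (the bottom edge, via `hbottom`)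
  have h2c : ∃ i j, i < j ∧ ¬ F ∣ G₀.coeff i ∧ ¬ F ∣ G₀.coeff j := by
    by_contra hnot
    push Not at hnot
    have hall : ∀ j, j ≠ i₁ → F ∣ G₀.coeff j := by
      intro j hj
      rcases lt_or_gt_of_ne hj with hlt | hgt
      · by_contra hj'
        exact hi₁ (hnot j i₁ hlt hj')
      · exact hnot i₁ j hgt hi₁
    apply hi₁
    refine hbottom (G₀.coeff i₁) fun w hw hw1 hw0 => ?_
    -- `P'(w) = 0` with `y₁(w) = 0` is `G₀(x_w; y₀(w)) = 0`, and `G₀ ≡ G₀_{i₁} y₀^{i₁}` on the curve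
    have hP'w := (hmem P').1 hP'mem w hw
    rw [hw1, ← hG₀] at hP'w
    have hdiff : ∀ j, F ∣ (G₀ - Polynomial.C (G₀.coeff i₁) * Polynomial.X ^ i₁).coeff j := by
      intro j
      rw [Polynomial.coeff_sub, Polynomial.coeff_C_mul_X_pow]
      by_cases hj : j = i₁
      · rw [if_pos hj, hj, sub_self]; exact dvd_zero F
      · rw [if_neg hj, sub_zero]; exact hall j hj
    rw [eval_eq_of_forall_dvd_sub F hdiff (hFall w hw), Polynomial.map_mul, Polynomial.map_pow,
      Polynomial.map_C, Polynomial.map_X, Polynomial.eval_mul, Polynomial.eval_pow, Polynomial.eval_C,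
      Polynomial.eval_X] at hP'w
    have h := (mul_eq_zero.1 hP'w).resolve_right (pow_ne_zero _ hw0)
    rwa [Polynomial.coe_eval₂RingHom, Polynomial.eval₂_eq_eval_map] at h
  -- the guarded engine with `S = W`, relation `P'`, guard `lc(P)`
  have hWcl : W = MvPolynomial.zeroLocus ℂ 𝔭 := eq_zeroLocus_vanishingIdeal_of_isZariskiClosed hmm.1.1
  refine unprojectedDense_bottomEdge_guard F hFirr hn hk hM hΦan hplace hz hdir P' G₀
    (fun x₀ x₁ y _ => hG₀ x₀ x₁ y) h2c F₃ hF₃ P.leadingCoeff htop hmm.1 (le_of_eq hmm.2.2.1) ?_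
  filter_upwards [hplace] with s hFs
  intro y hy0 hlc hP'y
  rw [hWcl, MvPolynomial.mem_zeroLocus_iff]
  intro G hG
  obtain ⟨Gy, hGy⟩ := exists_embed₄_poly ι hC h0 h1 h2 hX G
  obtain ⟨m, Q, H, hQH, hH⟩ := hdiv Gy (by rw [hGy]; exact hG)
  obtain ⟨H₁, rfl⟩ := (Polynomial.C_dvd_iff_dvd_coeff F₃ H).2 hH
  rw [MvPolynomial.aeval_eq_eval, ← hGy, hev]
  simp only [Sum.elim_inl, Sum.elim_inr, Matrix.cons_val_zero, Matrix.cons_val_one]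
  have hPpt : (P.map (MvPolynomial.eval ![(s ^ k)⁻¹, Φ s * (s ^ M)⁻¹,
      Complex.exp (Φ s * (s ^ M)⁻¹)])).eval y = 0 := by
    rw [hPP' _ _ _ _ hFs, hP'y, mul_zero]
  have h := congrArg (fun T : Polynomial (MvPolynomial (Fin 3) ℂ) =>
    (T.map (MvPolynomial.eval ![(s ^ k)⁻¹, Φ s * (s ^ M)⁻¹, Complex.exp (Φ s * (s ^ M)⁻¹)])).eval y) hQH
  simp only [Polynomial.map_mul, Polynomial.map_pow, Polynomial.map_C, Polynomial.map_add,
    Polynomial.eval_mul, Polynomial.eval_pow, Polynomial.eval_C, Polynomial.eval_add] at h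
  rw [hPpt, hF₃] at h
  simp only [Matrix.cons_val_zero, Matrix.cons_val_one] at h
  rw [hFs, mul_zero, zero_mul, add_zero] at h
  exact (mul_eq_zero.1 h).resolve_left (pow_ne_zero _ hlc)

/-- **THE `∀ W` THEOREM OVER `ℚ̄`-CURVES (no freeness hypothesis).**  `F ∈ ℚ̄[x₀][x₁]`
irreducible of positive `x₁`-degree; a place with a degenerate direction as above; `W` in
Mantova–Masser's case with base curve `{F = 0}` whose bottom edge is visible (`hbottom`).  Then
the unprojected exponential points are Zariski dense in `W` — when `x₀, x₁, y₁` satisfy a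
relation on `W` beyond `F`, `W` is a `y₀`-cylinder (file CIV) and file XCVIII applies.
[cite: MantovaMasser2023, §1 Further remarks, p. 5 (the question, open in general)] (new) -/
theorem unprojectedDense_of_mmCase_bottomEdge_algebraic (hFirr : Irreducible F)
    (halg : ∀ i j, IsAlgebraic ℚ ((F.coeff j).coeff i)) (hn : 1 ≤ F.natDegree)
    {k : ℕ} (hk : 1 ≤ k) {M : ℕ} (hM : 1 ≤ M) {Φ : ℂ → ℂ} (hΦan : AnalyticAt ℂ Φ 0)
    (hplace : ∀ᶠ s in 𝓝[≠] (0 : ℂ),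
      (F.map (Polynomial.evalRingHom (s ^ k)⁻¹)).eval (Φ s * (s ^ M)⁻¹) = 0)
    {z : ℂ} (hz : z ^ k = 2 * Real.pi * I) (hdir : (Φ 0 * z ^ M).re < 0)
    {W : Set (Fin 2 ⊕ Fin 2 → ℂ)} (hmm : MMCaseDimPiOneFree W)
    (hbase : MvPolynomial.zeroLocus ℂ (MvPolynomial.vanishingIdeal ℂ (projAdd '' (W ∩ torusLocus ℂ 2))) =
      {x : Fin 2 → ℂ | (F.map (Polynomial.evalRingHom (x 0))).eval (x 1) = 0})
    (hbottom : ∀ H : ℂ[X][X], (∀ w ∈ W, w (Sum.inr 1) = 0 → w (Sum.inr 0) ≠ 0 →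
      (H.map (Polynomial.evalRingHom (w (Sum.inl 0)))).eval (w (Sum.inl 1)) = 0) → F ∣ H) :
    UnprojectedDense W := by
  classical
  obtain ⟨F₃, hF₃⟩ := exists_curve₃ F
  by_cases hfree : ∀ H : MvPolynomial (Fin 3) ℂ,
      (∀ w ∈ W, MvPolynomial.eval ![w (Sum.inl 0), w (Sum.inl 1), w (Sum.inr 1)] H = 0) → F₃ ∣ H
  · exact unprojectedDense_of_mmCase_bottomEdge F hFirr hn hk hM hΦan hplace hz hdir F₃ hF₃ hmm
      hbase hfree hbottom
  · push Not at hfree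
    obtain ⟨H, hHW, hH⟩ := hfree
    obtain ⟨Ft, hFt, hcoeff⟩ := exists_transposeRows F
    exact unprojectedDense_of_mmCase_cylinder₀ F Ft hFt (irreducible_of_transposeRows hFirr hFt)
      (fun i j => by rw [hcoeff]; exact halg j i) hmm hbase
      (cylinder₀_of_relation F hFirr F₃ hF₃ hmm hbase H hH hHW)

end DegenerateAllSurfaces

end Summit.Schanuel.Schanuel.Theorems

end
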